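import Mathlib
import Summits.Parity.BatemanHorn.Theses.PolynomialMobius
import Summits.Parity.BatemanHorn.Theorems.IsogenyRedeiTypeIMainTerm
import HarnessLib

/-!
# Crux `PolyMobiusTail` (stmt-Parity-0870), line `stub_window_nonlinear`, stub W1
# `stub_nonlinear_window_of_level` — aux stub AUX2 `stub_windowMainTerm`: the main term is `o(x)`

After swapping the sums, the window `(x^{1-η}, x^{1+θ}]` of the Möbius tail of a Bateman–Horn
system `f` equals `x · M(x) + E(x)` with

  `M(x) = Σ_{d ∈ [1,⌊U⌋]^k} [L < ∏ dᵢ ≤ U] (∏ μ(dᵢ) log dᵢ) · G(d)`,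
  `L = x^{1-η}`, `U = x^{1+θ}`, `G = TypeIMainTerm.sysDensity f` (the CRT density).

This file proves `x · M(x) = o(x)`: regrouping the box by `m = ∏ dᵢ`
(`TypeIMainTerm.sum_box_filter_eq_sum_Ioc`), `M(x) = S(⌊U⌋₊) − S(⌊L⌋₊)` is a block of the tail
of the log-weighted singular series `S(N) = Σ_{m ≤ N} Σ_{d₁⋯d_k = m} G(d) ∏ μ(dᵢ) log dᵢ`, which
CONVERGES (`TypeIMainTerm.tendsto_singularSeries`, landed); both floors tend to `∞`, so
`M(x) → 0`.
-/

open Finset Filter Asymptotics Polynomial ArithmeticFunction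
open scoped Topology ArithmeticFunction.Moebius

namespace Summit.Parity.BatemanHorn.Theorems.PolyMobiusTail.NonlinearWindow

open Literature.NumberTheory.Sieve
open Summit.Parity.BatemanHorn.Theorems.TypeIMainTerm

variable {k : ℕ}

/-- Box sum with a product cut `∏ dᵢ ≤ X` over a LARGER box `[1,⌊Y⌋]^k`, `X ≤ Y`: the cut forces
`dᵢ ≤ ⌊X⌋` (all `dⱼ ≥ 1`), so the sum is the partial sum `Σ_{m ≤ ⌊X⌋} Σ_{d₁⋯d_k = m} G(d)`
(`sum_box_filter_eq_sum_Ioc`). -/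
private theorem windowMainTerm_boxSum_cut_eq (G : (Fin k → ℕ) → ℝ) {X Y : ℝ} (hX : 0 ≤ X) (hXY : X ≤ Y) :
    ∑ d ∈ Fintype.piFinset (fun _ : Fin k => Finset.Icc 1 ⌊Y⌋₊),
        (if ∏ i, (d i : ℝ) ≤ X then G d else 0) =
      ∑ m ∈ Finset.Ioc 0 ⌊X⌋₊, ∑ d ∈ Nat.finMulAntidiag k m, G d := by
  rw [← Finset.sum_filter, ← sum_box_filter_eq_sum_Ioc G hX]
  refine Finset.sum_congr ?_ fun _ _ => rfl
  ext d
  simp only [Finset.mem_filter, Fintype.mem_piFinset, Finset.mem_Icc]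
  constructor
  · rintro ⟨hd, hprod⟩
    refine ⟨fun i => ⟨(hd i).1, ?_⟩, hprod⟩
    have h1 : d i ≤ ∏ j, d j :=
      Nat.le_of_dvd (Finset.prod_pos fun j _ => (hd j).1)
        (Finset.dvd_prod_of_mem d (Finset.mem_univ i))
    have h2 : (d i : ℝ) ≤ ∏ j, (d j : ℝ) := by exact_mod_cast h1
    exact Nat.le_floor (h2.trans hprod)
  · rintro ⟨hd, hprod⟩
    exact ⟨fun i => ⟨(hd i).1, (hd i).2.trans (Nat.floor_le_floor hXY)⟩, hprod⟩

/-- The window sum over the box `[1,⌊U⌋]^k` with indicator `[L < ∏ dᵢ ≤ U]`, `0 ≤ L ≤ U`, is the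
difference of two partial sums of `Σ_m Σ_{d₁⋯d_k = m} G(d)`: at `⌊U⌋` and at `⌊L⌋`. -/
private theorem windowMainTerm_windowSum_eq_sub (G : (Fin k → ℕ) → ℝ) {L U : ℝ} (hL : 0 ≤ L) (hLU : L ≤ U) :
    ∑ d ∈ Fintype.piFinset (fun _ : Fin k => Finset.Icc 1 ⌊U⌋₊),
        (if L < ∏ i, (d i : ℝ) ∧ ∏ i, (d i : ℝ) ≤ U then G d else 0) =
      (∑ m ∈ Finset.Ioc 0 ⌊U⌋₊, ∑ d ∈ Nat.finMulAntidiag k m, G d) -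
        ∑ m ∈ Finset.Ioc 0 ⌊L⌋₊, ∑ d ∈ Nat.finMulAntidiag k m, G d := by
  rw [← windowMainTerm_boxSum_cut_eq G (hL.trans hLU) le_rfl,
    ← windowMainTerm_boxSum_cut_eq G hL hLU, ← Finset.sum_sub_distrib]
  refine Finset.sum_congr rfl fun d _ => ?_
  by_cases h : ∏ i, (d i : ℝ) ≤ L
  · have h1 : ¬(L < ∏ i, (d i : ℝ) ∧ ∏ i, (d i : ℝ) ≤ U) := fun h' => (not_lt.mpr h) h'.1
    rw [if_pos (h.trans hLU), if_pos h, sub_self, if_neg h1]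
  · rw [if_neg h, sub_zero]
    by_cases h' : ∏ i, (d i : ℝ) ≤ U
    · have h1 : L < ∏ i, (d i : ℝ) ∧ ∏ i, (d i : ℝ) ≤ U := ⟨not_le.mp h, h'⟩
      rw [if_pos h', if_pos h1]
    · have h1 : ¬(L < ∏ i, (d i : ℝ) ∧ ∏ i, (d i : ℝ) ≤ U) := fun h'' => h' h''.2
      rw [if_neg h', if_neg h1]

/-- **Aux stub `stub_windowMainTerm` (AUX2 of W1 `stub_nonlinear_window_of_level`): the main term
of the non-linear window is `o(x)`.**  For a Bateman–Horn system `f`, `θ > 0` and `0 < η < 1`,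
`x · Σ_{d ∈ [1,⌊x^{1+θ}⌋]^k} [x^{1-η} < ∏ dᵢ ≤ x^{1+θ}] (∏ μ(dᵢ) log dᵢ) · sysDensity f d = o(x)`:
the inner sum is the block `S(⌊x^{1+θ}⌋) − S(⌊x^{1-η}⌋)` of the tail of the convergent
log-weighted singular series (`TypeIMainTerm.tendsto_singularSeries`), hence tends to `0`. -/
theorem stub_windowMainTerm : ∀ (k : ℕ) (f : Fin k → ℤ[X]),
    Literature.NumberTheory.Sieve.IsBatemanHornSystem f → ∀ θ η : ℝ, 0 < θ → 0 < η → η < 1 →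
    (fun x : ℕ => (x : ℝ) * ∑ d ∈ Fintype.piFinset (fun _ : Fin k => Finset.Icc 1 ⌊(x : ℝ) ^ (1 + θ)⌋₊),
      if (x : ℝ) ^ (1 - η) < ∏ i, (d i : ℝ) ∧ ∏ i, (d i : ℝ) ≤ (x : ℝ) ^ (1 + θ) then
        (∏ i, ((ArithmeticFunction.moebius (d i) : ℝ) * Real.log (d i))) *
          Summit.Parity.BatemanHorn.Theorems.TypeIMainTerm.sysDensity f d else 0)
      =o[Filter.atTop] fun x : ℕ => (x : ℝ) := by
  intro k f hf θ η hθ hη hη1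
  classical
  -- the partial sums of the log-weighted singular series (factor order of the statement)
  set S : ℕ → ℝ := fun N => ∑ m ∈ Finset.Ioc 0 N, ∑ d ∈ Nat.finMulAntidiag k m,
    (∏ i, ((μ (d i) : ℝ) * Real.log (d i))) * sysDensity f d with hS
  have hSlim : Tendsto S atTop (𝓝 ((-1) ^ k * batemanHornConst f)) := by
    refine (tendsto_singularSeries f hf).congr fun N => ?_
    exact Finset.sum_congr rfl fun m _ => Finset.sum_congr rfl fun d _ => mul_comm _ _
  -- both floors tend to infinity
  have hU : Tendsto (fun x : ℕ => ⌊(x : ℝ) ^ (1 + θ)⌋₊) atTop atTop :=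
    tendsto_nat_floor_atTop.comp ((tendsto_rpow_atTop (by linarith)).comp tendsto_natCast_atTop_atTop)
  have hL : Tendsto (fun x : ℕ => ⌊(x : ℝ) ^ (1 - η)⌋₊) atTop atTop :=
    tendsto_nat_floor_atTop.comp ((tendsto_rpow_atTop (by linarith)).comp tendsto_natCast_atTop_atTop)
  -- the block of the tail tends to `0`
  have hT : Tendsto (fun x : ℕ => S ⌊(x : ℝ) ^ (1 + θ)⌋₊ - S ⌊(x : ℝ) ^ (1 - η)⌋₊) atTop (𝓝 0) := by
    have h := (hSlim.comp hU).sub (hSlim.comp hL)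
    rw [sub_self] at h
    exact h
  have ho : (fun x : ℕ => (x : ℝ) * (S ⌊(x : ℝ) ^ (1 + θ)⌋₊ - S ⌊(x : ℝ) ^ (1 - η)⌋₊)) =o[atTop]
      fun x : ℕ => (x : ℝ) := by
    have h := (isBigO_refl (fun x : ℕ => (x : ℝ)) atTop).mul_isLittleO ((isLittleO_one_iff ℝ).mpr hT)
    simpa only [mul_one] using h
  -- transport along the eventual identity `M(x) = S ⌊U⌋ − S ⌊L⌋`
  refine ho.congr' ?_ EventuallyEq.rfl
  filter_upwards [eventually_ge_atTop 1] with x hx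
  have hx1 : (1 : ℝ) ≤ x := by exact_mod_cast hx
  have hL0 : (0 : ℝ) ≤ (x : ℝ) ^ (1 - η) := Real.rpow_nonneg (Nat.cast_nonneg _) _
  have hLU : (x : ℝ) ^ (1 - η) ≤ (x : ℝ) ^ (1 + θ) :=
    Real.rpow_le_rpow_of_exponent_le hx1 (by linarith)
  rw [windowMainTerm_windowSum_eq_sub _ hL0 hLU]

end Summit.Parity.BatemanHorn.Theorems.PolyMobiusTail.NonlinearWindow
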